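import Summits.CriticalPhenomena.SAWScalingLimit.Theses.SAWBrickWallHomotopy
import Summits.CriticalPhenomena.SAWScalingLimit.Theorems.SAWDevelopingMapHexTransferNoBoundaryCreep
import Summits.CriticalPhenomena.SAWScalingLimit.Theorems.SAWBrickWallHomotopyModulusUniversalityBoundaryAvoidanceHexOfHexConjecture
import Summits.CriticalPhenomena.SAWScalingLimit.Theorems.SAWBrickWallHomotopyModulusUniversalityBoundaryAvoidanceTransport
import Summits.CriticalPhenomena.SAWScalingLimit.Theorems.SAWBrickWallHomotopyModulusUniversalityBrickWallGoodEndpointApprox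
import Literature.Probability.Percolation.QuadCrossingCrossedEventInterior
import HarnessLib

/-!
# `ModulusUniversality`, line `birth`: boundary avoidance of the straight brick-wall law from (R)

Helper file (`--supports stmt-CriticalPhenomena-5790`) of the line `birth` / `registered` for the
crux `SAWBrickWallHomotopy.ModulusUniversality` (skeleton
`Summits/CriticalPhenomena/SAWScalingLimit/Cruxes/ModulusUniversality/Lines/birth.lean`, reshape 7,
lead c3): the registered PROVABLE stub `stub_boundaryAvoidanceBW_of_bwRobust` (W2), literal signature —
(H) `HexConjecture` and (R) `stub_bwRobust` (convergence in law of the critical straight brick-wall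
curves, straightened by `B⁻¹`, `B = diag(2, 2/√3)`, to SLE₈⸝₃ in `B⁻¹E`, along every `ℤ²` endpoint
approximation making the law eventually a probability measure) imply the former leaf (BA_bw): boundary
avoidance of the straight brick-wall law away from the marked points, for EVERY `ℤ²` endpoint
approximation.

## Proof

* `noBoundaryCreep_of_convergesInLawToSLE` — the lattice-free core of the tree theorem
  `YbRelay.hex_noBoundaryCreep_of_hexSAWScalingLimit` (portmanteau for the closed set of curve classes
  meeting the closed layer `{infDist(·, ∂D) ≤ η, far from both marks}` + Rohde–Schramm Thm 6.1
  `IsSLELaw.ae_simple`, discharged in the tree), re-run for an ARBITRARY family of measurable random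
  curve classes under `0`-or-probability laws converging in law to SLE₈⸝₃.
* `boundaryAvoidanceBW_of_convergesInLawToSLE` — transfer through the affinity: a visited site
  `x ≠ a_δ` lies in the discrete domain, so `δx ∈ E`, `B⁻¹(δx)` is on the straightened trace,
  `infDist(B⁻¹(δx), ∂(B⁻¹E)) ≤ infDist(δx, Eᶜ)` (`‖z‖ ≤ ‖Bz‖`, `infDist_compl_preimage_le`) and
  `dist(B⁻¹(δx), B⁻¹ E.pt i) ≥ dist(δx, E.pt i)/2` (`‖Bz‖ ≤ 2‖z‖`, `dist_affinityB_le`).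
* The eventual-probability proviso of (R).  The straight brick-wall law is `0` or a probability
  measure at each `δ` (`WeaklySAW.normalize_dichotomy`); where it is `0` the estimate is free, but (R)
  only speaks of approximations that are EVENTUALLY probability.  So the given approximation is
  patched, off the set `S` of its good meshes, with a brick-wall-good endpoint approximation of `E`
  (`exists_isEndpointApprox_isProbabilityMeasure_brickWallLaw`,
  `Theorems/SAWBrickWallHomotopyModulusUniversalityBrickWallGoodEndpointApprox.lean`).  The patched
  approximation agrees with the given one on `S`, is an endpoint approximation
  (`tendsto_of_piecewise_eq`) and is eventually probability, so (R), fed with (H), and the two lemmas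
  above bound its collar-visit probability; on `S` this is the wanted bound, off `S` the law is `0`.
All bookkeeping tagged [folklore].  No definitions.
-/

noncomputable section

open MeasureTheory Filter Topology Metric Set
open scoped NNReal ENNReal
open Literature.Probability.LatticeModels
open Literature.Probability.RandomPlanarGeometry

namespace Summit.CriticalPhenomena.SAWScalingLimit.Cruxes.ModulusUniversality.Birth

open Summit.CriticalPhenomena.SAWScalingLimit.Cruxes.HexTransfer.YbRelay
  (isClosed_setOf_range_inter_nonempty isClosed_layer)
open Literature.Probability (Process.preWienerMeasure)

/-! ### 1. No boundary creep for an arbitrary family converging in law to SLE₈⸝₃ -/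

/-- **No boundary creep under convergence to SLE₈⸝₃ (lattice-free form of
`YbRelay.hex_noBoundaryCreep_of_hexSAWScalingLimit`).**  If measurable random curve classes `X δ` under
`0`-or-probability laws `P δ` converge in law to chordal SLE₈⸝₃ in the Dobrushin domain `D`, then for
every `ρ > 0`, `ε > 0` there is `η > 0` such that, eventually in `δ`, the `P δ`-mass of the curves
meeting the closed layer `{z | infDist z ∂D ≤ η, dist z (D.pt i) ≥ ρ}` is `≤ ε`: the set of curve
classes meeting the layer is closed, portmanteau bounds the limsup by the SLE mass, the layers shrink to
`{meets ∂D far from the marks}`, which is SLE-null by Rohde–Schramm Thm 6.1 (`IsSLELaw.ae_simple`,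
discharged in the tree), and continuity from above finishes. [folklore] -/
theorem noBoundaryCreep_of_convergesInLawToSLE {Ωδ : ℝ → Type*} [∀ δ, MeasurableSpace (Ωδ δ)]
    {X : ∀ δ, Ωδ δ → CurveClass ℂ} {P : ∀ δ, Measure (Ωδ δ)} {D : DobrushinDomain}
    (hX : ∀ δ, Measurable (X δ)) (hP : ∀ δ, P δ = 0 ∨ IsProbabilityMeasure (P δ))
    (hconv : ConvergesInLawToSLE ((8 : ℝ≥0) / 3) D X P) {ρ : ℝ} (hρ : 0 < ρ) {ε : ℝ}
    (hε : 0 < ε) :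
    ∃ η : ℝ, 0 < η ∧ ∀ᶠ δ in 𝓝[>] (0 : ℝ), P δ {ω | ∃ z ∈ (X δ ω).range,
      infDist z (frontier D.carrier) ≤ η ∧ ρ ≤ dist z (D.pt 0) ∧ ρ ≤ dist z (D.pt 1)} ≤
        ENNReal.ofReal ε := by
  classical
  haveI := isProbabilityMeasure_preWienerMeasure'
  obtain ⟨Γ, hΓ, -, hT⟩ := hconv
  -- the layers and the closed sets of curve classes meeting them
  let K : ℝ → Set ℂ := fun η =>
    {z : ℂ | infDist z (frontier D.carrier) ≤ η ∧ ρ ≤ dist z (D.pt 0) ∧ ρ ≤ dist z (D.pt 1)}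
  let C : ℝ → Set (CurveClass ℂ) := fun η => {c | (c.range ∩ K η).Nonempty}
  have hCcl : ∀ η, IsClosed (C η) := fun η => isClosed_setOf_range_inter_nonempty (isClosed_layer D ρ η)
  have hCmeas : ∀ η, MeasurableSet (C η) := fun η => (hCcl η).measurableSet
  have hCmono : Antitone fun n : ℕ => C (1 / ((n : ℝ) + 1)) := by
    intro m n hmn c hc
    obtain ⟨z, hz, hz1, hz2⟩ := hc
    refine ⟨z, hz, hz1.trans ?_, hz2⟩
    exact one_div_le_one_div_of_le (by positivity) (by exact_mod_cast Nat.succ_le_succ hmn)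
  -- the SLE law charges no curve meeting `∂D` away from the marked points
  let μ : Measure (CurveClass ℂ) := Process.preWienerMeasure.map Γ
  haveI hμ : IsProbabilityMeasure μ := Measure.isProbabilityMeasure_map hΓ.aemeasurable
  have hμ0 : μ (⋂ n : ℕ, C (1 / ((n : ℝ) + 1))) = 0 := by
    have hs := IsSLELaw.ae_simple ae_isSimpleTrace_sleTrace_of_le_four_holds
      CurveClass.measurableSet_simple_holds (by positivity)
      (by rw [div_le_iff₀ (by norm_num : (0 : ℝ≥0) < 3)]; norm_num) hΓ.isSLELaw_map
    refine measure_mono_null (fun c hc => ?_) (ae_iff.1 hs)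
    simp only [mem_setOf_eq]
    intro hgood
    rw [mem_iInter] at hc
    choose z hz using fun n => hc n
    obtain ⟨w, hw, φ, hφ, hwφ⟩ := (CurveClass.isCompact_range c).tendsto_subseq fun n => (hz n).1
    have hlim : Tendsto (fun n : ℕ => 1 / ((φ n : ℝ) + 1)) atTop (𝓝 0) := by
      have h0 : Tendsto (fun n : ℕ => 1 / ((n : ℝ) + 1)) atTop (𝓝 0) :=
        tendsto_one_div_add_atTop_nhds_zero_nat
      exact h0.comp hφ.tendsto_atTop
    have hw1 : infDist w (frontier D.carrier) ≤ 0 :=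
      le_of_tendsto_of_tendsto ((continuous_infDist_pt _).continuousAt.tendsto.comp hwφ) hlim
        (Eventually.of_forall fun n => (hz (φ n)).2.1)
    have hwfr : w ∈ frontier D.carrier := by
      have h0 : infDist w (frontier D.carrier) = 0 := le_antisymm hw1 infDist_nonneg
      have hne : (frontier D.carrier).Nonempty := ⟨D.pt 0, D.pt_mem_frontier 0⟩
      exact (isClosed_frontier.mem_iff_infDist_zero hne).2 h0
    have hwa : ρ ≤ dist w (D.pt 0) :=
      ge_of_tendsto ((continuous_id.dist continuous_const).continuousAt.tendsto.comp hwφ)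
        (Eventually.of_forall fun n => (hz (φ n)).2.2.1)
    have hwb : ρ ≤ dist w (D.pt 1) :=
      ge_of_tendsto ((continuous_id.dist continuous_const).continuousAt.tendsto.comp hwφ)
        (Eventually.of_forall fun n => (hz (φ n)).2.2.2)
    have hmem := hgood.2 ⟨hw, hwfr⟩
    simp only [mem_insert_iff, mem_singleton_iff] at hmem
    rcases hmem with rfl | rfl
    · simp at hwa; linarith
    · simp at hwb; linarith
  -- continuity from above: some layer has SLE-mass `< ε`
  have hμlim : Tendsto (fun n : ℕ => μ (C (1 / ((n : ℝ) + 1)))) atTop (𝓝 0) := by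
    have h := tendsto_measure_iInter_atTop (μ := μ) (fun n => (hCmeas _).nullMeasurableSet) hCmono
      ⟨0, measure_ne_top μ _⟩
    rwa [hμ0] at h
  obtain ⟨N, hN⟩ := (ENNReal.tendsto_atTop_zero.1 hμlim) (ENNReal.ofReal (ε / 2))
    (ENNReal.ofReal_pos.2 (half_pos hε))
  have hNle : μ (C (1 / ((N : ℝ) + 1))) ≤ ENNReal.ofReal (ε / 2) := hN N le_rfl
  refine ⟨1 / ((N : ℝ) + 1), by positivity, ?_⟩
  -- package the laws as probability measures on `CurveClass ℂ` (junk off the good set)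
  have hev : ∀ᶠ δ in 𝓝[>] (0 : ℝ), IsProbabilityMeasure (P δ) := by
    have h1 := hT (BoundedContinuousFunction.const (CurveClass ℂ) 1)
    simp only [BoundedContinuousFunction.const_apply, integral_const, smul_eq_mul, mul_one,
      probReal_univ] at h1
    filter_upwards [h1.eventually (lt_mem_nhds one_half_lt_one)] with δ hδ
    rcases hP δ with h0 | hp
    · rw [h0] at hδ
      norm_num at hδ
    · exact hp
  let ν : ProbabilityMeasure (CurveClass ℂ) := ⟨μ, hμ⟩
  let νs : ℝ → ProbabilityMeasure (CurveClass ℂ) := fun δ =>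
    if hδ : IsProbabilityMeasure (P δ) then
      ⟨(P δ).map (X δ), Measure.isProbabilityMeasure_map (hX δ).aemeasurable⟩
    else ν
  have hT' : Tendsto νs (𝓝[>] 0) (𝓝 ν) := by
    rw [ProbabilityMeasure.tendsto_iff_forall_integral_tendsto]
    intro f
    have h1 := hT f
    have e2 : ∫ x, f x ∂(ν : Measure (CurveClass ℂ)) = ∫ ω, f (Γ ω) ∂Process.preWienerMeasure :=
      integral_map hΓ.aemeasurable f.continuous.aestronglyMeasurable
    rw [e2]
    refine h1.congr' ?_
    filter_upwards [hev] with δ hδ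
    simp only [νs, dif_pos hδ, ProbabilityMeasure.coe_mk]
    exact (integral_map (hX δ).aemeasurable f.continuous.aestronglyMeasurable).symm
  have hlimsup := ProbabilityMeasure.limsup_measure_closed_le_of_tendsto hT' (hCcl (1 / ((N : ℝ) + 1)))
  have hlt : limsup (fun δ => (νs δ : Measure (CurveClass ℂ)) (C (1 / ((N : ℝ) + 1)))) (𝓝[>] 0) <
      ENNReal.ofReal ε :=
    lt_of_le_of_lt (hlimsup.trans hNle) ((ENNReal.ofReal_lt_ofReal_iff hε).2 (by linarith))
  filter_upwards [hev, Filter.eventually_lt_of_limsup_lt hlt] with δ hδ h2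
  have key : P δ {ω | ∃ z ∈ (X δ ω).range,
      infDist z (frontier D.carrier) ≤ 1 / ((N : ℝ) + 1) ∧ ρ ≤ dist z (D.pt 0) ∧ ρ ≤ dist z (D.pt 1)} =
      (νs δ : Measure (CurveClass ℂ)) (C (1 / ((N : ℝ) + 1))) := by
    simp only [νs, dif_pos hδ, ProbabilityMeasure.coe_mk]
    rw [Measure.map_apply (hX δ) (hCmeas _)]
    rfl
  rw [key]
  exact h2.le

/-! ### 2. Transfer through the affinity `B = diag(2, 2/√3)` -/

section Affinity

variable {B : ℂ ≃ₜ ℂ}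
  (hB : ∀ z : ℂ, B z = ((2 * z.re : ℝ) : ℂ) + ((2 / Real.sqrt 3 * z.im : ℝ) : ℂ) * Complex.I)
include hB

/-- **Boundary avoidance of the straight brick-wall law along an endpoint approximation whose
straightened curves converge in law to SLE₈⸝₃ in `B⁻¹E`.**  Apply
`noBoundaryCreep_of_convergesInLawToSLE` in `B⁻¹E = E.map B.symm` with `ρ/2`; the site event is
contained in the curve event: eventually `dist(δ a_δ, E.pt 0) < ρ`, so a visited site `x` at distance
`≥ ρ` from `E.pt 0` is not the starting vertex, lies in `Ω_δ` (`mem_meshDomain_of_mem_support_of_ne`),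
`δx ∈ E`, `z = B⁻¹(δx)` is on the straightened trace (`Walk.mem_range_toCurve`, `CurveClass.range_map`),
`infDist(z, ∂(B⁻¹E)) ≤ infDist(z, (B⁻¹E)ᶜ) ≤ infDist(δx, Eᶜ) < η` (`infDist_compl_preimage_le`) and
`dist(z, B⁻¹(E.pt i)) ≥ dist(δx, E.pt i)/2 ≥ ρ/2` (`dist_affinityB_le`). [folklore] -/
theorem boundaryAvoidanceBW_of_convergesInLawToSLE {E : DobrushinDomain} {a b : ℝ → Site 2}
    (hab : SAW.IsEndpointApprox E a b)
    (hconv : ConvergesInLawToSLE ((8 : ℝ≥0) / 3) (E.map B.symm)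
      (fun δ (γ : SAW.DomainSAW E.carrier δ (a δ) (b δ)) =>
        CurveClass.map (B.symm : C(ℂ, ℂ)) γ.curve)
      (fun δ => SAW.brickWallLaw E.carrier δ 0 (a δ) (b δ)))
    {ρ : ℝ} (hρ : 0 < ρ) {ε : ℝ} (hε : 0 < ε) :
    ∃ η : ℝ, 0 < η ∧ ∀ᶠ δ in 𝓝[>] (0 : ℝ), SAW.brickWallLaw E.carrier δ 0 (a δ) (b δ)
      {γ | ∃ x ∈ γ.walk.support, infDist (meshPoint δ x) E.carrierᶜ < η ∧
        ∀ i, ρ ≤ dist (meshPoint δ x) (E.pt i)} ≤ ENNReal.ofReal ε := by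
  obtain ⟨η, hη, hev⟩ := noBoundaryCreep_of_convergesInLawToSLE
    (fun δ => SAW.DomainSAW.measurable_of_top _)
    (fun δ => Literature.Probability.RandomPlanarGeometry.WeaklySAW.normalize_dichotomy _)
    hconv (half_pos hρ) hε
  refine ⟨η, hη, ?_⟩
  have hnear : ∀ᶠ δ : ℝ in 𝓝[>] (0 : ℝ), dist (meshPoint δ (a δ)) (E.pt 0) < ρ :=
    hab.tendsto_fst (Metric.ball_mem_nhds _ hρ)
  filter_upwards [hev, hnear] with δ h1 h2
  refine le_trans (measure_mono ?_) h1
  rintro γ ⟨x, hx, hcollar, hfar⟩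
  have hne : x ≠ a δ := by
    rintro rfl
    exact absurd (hfar 0) (not_le.2 h2)
  have hxE : meshPoint δ x ∈ E.carrier :=
    meshDomain_subset_meshVertices _ _ (mem_meshDomain_of_mem_support_of_ne γ.walk hx hne)
  have hzE' : B.symm (meshPoint δ x) ∈ (E.map B.symm).carrier := ⟨meshPoint δ x, hxE, rfl⟩
  have hhalf : ∀ i, ρ / 2 ≤ dist (B.symm (meshPoint δ x)) ((E.map B.symm).pt i) := by
    intro i
    have := dist_affinityB_le hB (B.symm (meshPoint δ x)) (B.symm (E.pt i))
    rw [B.apply_symm_apply, B.apply_symm_apply] at this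
    rw [MarkedDomain.pt_map]
    linarith [hfar i]
  refine ⟨B.symm (meshPoint δ x), ?_, ?_, hhalf 0, hhalf 1⟩
  · rw [CurveClass.range_map]
    refine ⟨meshPoint δ x, ?_, rfl⟩
    show meshPoint δ x ∈ (CurveClass.mk ⟨γ.walk.toCurve (meshPoint δ)⟩).range
    rw [CurveClass.range_mk]
    exact SimpleGraph.Walk.mem_range_toCurve _ _ hx
  · refine (infDist_frontier_le_infDist_compl (E.map B.symm).carrier_ne_univ hzE').trans ?_
    rw [MarkedDomain.carrier_map]
    refine (infDist_compl_preimage_le hB E.isBounded _).trans ?_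
    rw [B.apply_symm_apply]
    exact hcollar.le

end Affinity

/-! ### 3. The registered stub -/

/-- A function agreeing with `f` on `S` and with `g` off `S` tends to any common limit filter of `f`
and `g`. [folklore] -/
theorem tendsto_of_piecewise_eq {α β : Type*} {l : Filter α} {l' : Filter β} {f g h : α → β}
    {S : Set α} (hf : Tendsto f l l') (hg : Tendsto g l l') (hS : ∀ x ∈ S, h x = f x)
    (hn : ∀ x ∉ S, h x = g x) : Tendsto h l l' := by
  rw [Filter.tendsto_def]
  intro s hs
  filter_upwards [Filter.tendsto_def.1 hf s hs, Filter.tendsto_def.1 hg s hs] with x hx hx'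
  by_cases h' : x ∈ S
  · show h x ∈ s
    rw [hS x h']
    exact hx
  · show h x ∈ s
    rw [hn x h']
    exact hx'

/-- **STUB W2 of line `birth` (reshape 7) — `stub_boundaryAvoidanceBW_of_bwRobust` (registered
signature, literal): (H) ∧ (R) ⇒ (BA_bw).**  Fix the affinity `B = diag(2, 2/√3)`
(`stretchHomeomorph`), `E`, a `ℤ²` endpoint approximation `(a, b)`, `ρ, ε > 0`.  Let `S` be the set
of meshes at which the straight brick-wall law of `(E, a_δ, b_δ)` is a probability measure (it is `0`
at the others, `WeaklySAW.normalize_dichotomy`), and `(a₀, b₀)` a brick-wall-good endpoint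
approximation of `E` (`exists_isEndpointApprox_isProbabilityMeasure_brickWallLaw`).  The patched
approximation `(a', b') = (a, b)` on `S`, `= (a₀, b₀)` off `S` is an endpoint approximation
(`tendsto_of_piecewise_eq`) along which the law is eventually a probability measure, so (R), fed with
(H), makes its straightened curves converge in law to SLE₈⸝₃ in `B⁻¹E`, and
`boundaryAvoidanceBW_of_convergesInLawToSLE` bounds its collar-visit probability by `ε` eventually;
on `S` this is the claim, off `S` the law is `0`. [folklore] -/
theorem stub_boundaryAvoidanceBW_of_bwRobust :
    Summit.CriticalPhenomena.SAWScalingLimit.Theses.SAWBrickWallHomotopy.HexConjecture → (Summit.CriticalPhenomena.SAWScalingLimit.Theses.SAWBrickWallHomotopy.HexConjecture → ∀ B : ℂ ≃ₜ ℂ, (∀ z : ℂ, B z = ((2 * z.re : ℝ) : ℂ) + ((2 / Real.sqrt 3 * z.im : ℝ) : ℂ) * Complex.I) → ∀ (E : DobrushinDomain) (a b : ℝ → Site 2), SAW.IsEndpointApprox E a b → (∀ᶠ δ in nhdsWithin 0 (Set.Ioi 0), IsProbabilityMeasure (SAW.brickWallLaw E.carrier δ 0 (a δ) (b δ))) → ConvergesInLawToSLE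 ((8 : NNReal) / 3) (E.map B.symm) (fun δ (γ : SAW.DomainSAW E.carrier δ (a δ) (b δ)) => CurveClass.map (B.symm : C(ℂ, ℂ)) γ.curve) (fun δ => SAW.brickWallLaw E.carrier δ 0 (a δ) (b δ))) → ∀ (E : DobrushinDomain) (a b : ℝ → Site 2), SAW.IsEndpointApprox E a b → ∀ ρ : ℝ, 0 < ρ → ∀ ε : ℝ, 0 < ε → ∃ η : ℝ, 0 < η ∧ ∀ᶠ δ in nhdsWithin 0 (Set.Ioi 0), SAW.brickWallLaw E.carrier δ 0 (a δ) (b δ) {γ | ∃ x ∈ γ.walk.support, Metric.infDist (meshPoint δ x) E.carrierᶜ < η ∧ ∀ i, ρ ≤ dist (meshPoint δ x) (E.pt i)} ≤ ENNReal.ofReal ε := by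
  classical
  intro hHex hR E a b hab ρ hρ ε hε
  -- the affinity `B = diag(2, 2/√3)`
  have h3 : 0 < Real.sqrt 3 := Real.sqrt_pos.2 (by norm_num)
  have h23 : (0 : ℝ) < 2 / Real.sqrt 3 := div_pos two_pos h3
  obtain ⟨B, hB⟩ : ∃ B : ℂ ≃ₜ ℂ,
      ∀ z : ℂ, B z = ((2 * z.re : ℝ) : ℂ) + ((2 / Real.sqrt 3 * z.im : ℝ) : ℂ) * Complex.I :=
    ⟨Literature.Probability.Percolation.QuadCrossing.stretchHomeomorph 2 (2 / Real.sqrt 3) two_pos h23,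
      fun z => by
        rw [Literature.Probability.Percolation.QuadCrossing.stretchHomeomorph_apply,
          Complex.mk_eq_add_mul_I]⟩
  -- the good meshes `S`, a brick-wall-good approximation `(a₀, b₀)`, and the patched `(a', b')`
  set S : Set ℝ := {δ | IsProbabilityMeasure (SAW.brickWallLaw E.carrier δ 0 (a δ) (b δ))}
    with hS_def
  obtain ⟨a₀, b₀, hab₀, hprob₀⟩ := exists_isEndpointApprox_isProbabilityMeasure_brickWallLaw E
  obtain ⟨a', ha'S, ha'n⟩ : ∃ a' : ℝ → Site 2, (∀ δ ∈ S, a' δ = a δ) ∧ ∀ δ ∉ S, a' δ = a₀ δ :=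
    ⟨fun δ => if δ ∈ S then a δ else a₀ δ, fun δ h => if_pos h, fun δ h => if_neg h⟩
  obtain ⟨b', hb'S, hb'n⟩ : ∃ b' : ℝ → Site 2, (∀ δ ∈ S, b' δ = b δ) ∧ ∀ δ ∉ S, b' δ = b₀ δ :=
    ⟨fun δ => if δ ∈ S then b δ else b₀ δ, fun δ h => if_pos h, fun δ h => if_neg h⟩
  have hab' : SAW.IsEndpointApprox E a' b' := by
    refine ⟨?_, ?_, ?_⟩
    · filter_upwards [hab.reachable, hab₀.reachable] with δ h h₀
      by_cases hδ : δ ∈ S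
      · rw [ha'S δ hδ, hb'S δ hδ]; exact h
      · rw [ha'n δ hδ, hb'n δ hδ]; exact h₀
    · exact tendsto_of_piecewise_eq hab.tendsto_fst hab₀.tendsto_fst
        (fun δ hδ => by rw [ha'S δ hδ]) (fun δ hδ => by rw [ha'n δ hδ])
    · exact tendsto_of_piecewise_eq hab.tendsto_snd hab₀.tendsto_snd
        (fun δ hδ => by rw [hb'S δ hδ]) (fun δ hδ => by rw [hb'n δ hδ])
  have hprob' : ∀ᶠ δ in 𝓝[>] (0 : ℝ),
      IsProbabilityMeasure (SAW.brickWallLaw E.carrier δ 0 (a' δ) (b' δ)) := by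
    filter_upwards [hprob₀] with δ h₀
    by_cases hδ : δ ∈ S
    · rw [ha'S δ hδ, hb'S δ hδ]; exact hδ
    · rw [ha'n δ hδ, hb'n δ hδ]; exact h₀
  -- (R), fed with (H), along the patched approximation; boundary avoidance along it
  have hconv := hR hHex B hB E a' b' hab' hprob'
  obtain ⟨η, hη, hev⟩ := boundaryAvoidanceBW_of_convergesInLawToSLE hB hab' hconv hρ hε
  refine ⟨η, hη, ?_⟩
  filter_upwards [hev] with δ hδ
  by_cases hS : δ ∈ S
  · rw [ha'S δ hS, hb'S δ hS] at hδ
    exact hδ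
  · have h0 : SAW.brickWallLaw E.carrier δ 0 (a δ) (b δ) = 0 :=
      (Literature.Probability.RandomPlanarGeometry.WeaklySAW.normalize_dichotomy _).resolve_right hS
    rw [h0]
    exact bot_le

end Summit.CriticalPhenomena.SAWScalingLimit.Cruxes.ModulusUniversality.Birth

end
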